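import Literature.AlgebraicGeometry.ComplexMultiplication.AndreProductFormBiproduct
import HarnessLib

/-!
# André 1992 in product form — part 3: the auxiliary variety
# `B̃ = ⨁_{(i,g)} A_i`, its line basis in the index convention of the carrier lemmas, and the twisted slot products

The CONSTRUCTIONS of the kernel proof
of `HodgeTheory.Andre1992_hodgeClasses_cmTypedProduct_mem_span_pullback_weilLines` (file
`ComplexMultiplication/AndreProductFormHolds.lean`) — Charles–Schnell's `V ⊗_ℚ E ≅ ⊕_{(i,g)} E_{gφ_i}` / Milne's endnote M.12
`A_J` realised as biproducts of the given realisations; no case of the Hodge conjecture is proved and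
nothing about algebraic cycles is asserted. Contents (all PROVED, definitions proof-internal):

* `B̃ = ⨁_{(i,g) ∈ Fin n × Gal(K/ℚ)} A_i` with `𝓞_K` acting on slot `(i,g)` by `ι_i ∘ g⁻¹` (`Btilde`, `slotAct`,
  `Yact`), the diagonal `ι₀ : ⨁ A_i ⟶ B̃` and `π = Σ_g P_g : B̃ ⟶ ⨁ A_i`; the LINE BASIS of `H¹(B̃)`
  (`lineBasis0`: `pr_{(i,g)}^* v_{i,σ}`) on which `a` acts by the label `(σ ∘ g⁻¹)(a)` (`map_Yact_lineBasis0`),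
  with `ι₀^*(line) =` the line `(i,σ)` of `⨁ A_i` and `π^*(line (i,σ)) = Σ_g line((i,g),σ)`;
* the reindexing to `Fin N × Fin e` (`idx`, `𝔅`, `xB`) — literally the hypotheses `hY𝔅`, `hι𝔅`, `hπ𝔅` of
  the key identity `andre_keyIdentity` of `AndreProductFormBiproductHOne` (`map_Yact_𝔅`, `map_iota0_𝔅`, `map_piSum_xB`);
* for a slot set `α` of size `d`: the twisted slot product `B_α = ⨁_j A_{i_j}` (`Bα`), `q_α : B̃ ⟶ B_α`,
  `j_α : B_α ⟶ B̃`, the twisted action `Yα`, `ι₀ ≫ q_α =` multi-diagonal (`iota0_qα`), `𝓞_K`-equivariance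
  of `j_α` (`jα_Yact`), and the slot idempotent `q_α ≫ j_α` acting on the line basis by the indicator of `α`
  (`map_eα_lineBasis0`).

## References
* [CharlesSchnell2014Notes] F. Charles, C. Schnell, *Notes on absolute Hodge classes* (2014), proof of Thm. 11.5.21 (pp. 510–511).
* [Deligne1982HodgeCycles] P. Deligne (notes by J. S. Milne), LNM 900 (1982), Milne's endnote M.12 (p. 64).
* [Milne2020HodgeClassesAV] J. S. Milne, *Hodge classes on abelian varieties* (2020), Theorem 1 (proof).

Provenance: Literature home (namespace `Literature.AlgebraicGeometry.ComplexMultiplication.AndreProductForm`) of the Summits-side `HodgeConjecture/CorCM/AndreProductFormAuxiliary` (a step of the kernel proof of André's 1992 theorem in product form, whose imports are `Literature/` and Mathlib only); re-homed so that the Literature record `HodgeTheory.Andre1992_hodgeClasses_cmTypedProduct_mem_span_pullback_weilLines` is discharged Literature-side. Lane `lit-hodgefound` (Layer A3/A4: CM abelian varieties and their Hodge classes), seat p20.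
-/

noncomputable section

namespace Literature.AlgebraicGeometry.ComplexMultiplication.AndreProductForm

open NumberField

variable (K : Type) [Field K] [NumberField K]

/-! ## The auxiliary variety `B̃ = ⨁_{(i,g)} A_i` with its twisted `𝓞_K`-action -/

section Construction

open _root_.CategoryTheory _root_.CategoryTheory.Limits
open Literature.AlgebraicGeometry Literature.AlgebraicGeometry.Motives Literature.AlgebraicGeometry.HodgeTheory
open Literature.AlgebraicGeometry.ComplexMultiplication
open Literature.NumberTheory.Automorphic.PicardCM (eigenline)

variable {n : ℕ} (A : Fin n → AbelianVariety ℂ) (ι : ∀ i, 𝓞 K →+* End (A i))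

/-- The slots `(i, g)`: a factor index and a Galois twist. [cite: CharlesSchnell2014Notes, proof of Thm. 11.5.21 (pp. 510–511), auxiliary construction] -/
abbrev Slot (n : ℕ) : Type := Fin n × (K ≃ₐ[ℚ] K)

/-- The slot varieties `A_i`. [cite: CharlesSchnell2014Notes, proof of Thm. 11.5.21 (pp. 510–511), auxiliary construction] -/
abbrev slotAV : Slot K n → AbelianVariety ℂ := fun q => A q.1

/-- The twisted action `ι_i ∘ g⁻¹` on the slot `(i, g)`. [cite: Deligne1982HodgeCycles, endnote M.12 (p. 64)] -/
def slotAct (q : Slot K n) : 𝓞 K →+* End (slotAV K A q) :=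
  (ι q.1).comp (RingOfIntegers.mapRingEquiv q.2.toRingEquiv.symm).toRingHom

/-- Unfolding of `slotAct`. [cite: CharlesSchnell2014Notes, proof of Thm. 11.5.21 (pp. 510–511), auxiliary step] -/
theorem slotAct_apply (q : Slot K n) (a : 𝓞 K) :
    slotAct K A ι q a = ι q.1 (RingOfIntegers.mapRingEquiv q.2.toRingEquiv.symm a) := rfl

/-- `B̃ = ⨁_{(i,g)} A_i`. [cite: CharlesSchnell2014Notes, proof of Thm. 11.5.21 (V ⊗ E ≅ ⊕ E_{gφ_i})] -/
abbrev Btilde : AbelianVariety ℂ := ⨁ slotAV K A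

/-- The diagonal twisted action of `a ∈ 𝓞_K` on `B̃`. [cite: Deligne1982HodgeCycles, endnote M.12 (p. 64)] -/
def Yact (a : 𝓞 K) : Btilde K A ⟶ Btilde K A := biproduct.map fun q => slotAct K A ι q a

/-- `ι₀ : ⨁ A_i ⟶ B̃`, the diagonal (slot `(i,g)` receives `pr_i`). [cite: Deligne1982HodgeCycles, endnote M.12 (the diagonal map f_J)] -/
def iota0 : (⨁ A) ⟶ Btilde K A := biproduct.lift fun q => biproduct.π A q.1

/-- `P_g : B̃ ⟶ ⨁ A_i`, the projection onto the `g`-th copy. [cite: CharlesSchnell2014Notes, proof of Thm. 11.5.21 (pp. 510–511), auxiliary construction] -/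
def Pg (g : K ≃ₐ[ℚ] K) : Btilde K A ⟶ ⨁ A := biproduct.lift fun i => biproduct.π (slotAV K A) (i, g)

/-- `π = Σ_g P_g : B̃ ⟶ ⨁ A_i`. [cite: CharlesSchnell2014Notes, proof of Thm. 11.5.21 (pp. 510–511), auxiliary construction] -/
def piSum : Btilde K A ⟶ ⨁ A := ∑ g, Pg K A g

/-- The slot-`(i,g)` component of `ι₀` is `pr_i`. [cite: CharlesSchnell2014Notes, proof of Thm. 11.5.21 (pp. 510–511), auxiliary step] -/
theorem iota0_π (q : Slot K n) : iota0 K A ≫ biproduct.π (slotAV K A) q = biproduct.π A q.1 :=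
  biproduct.lift_π _ _

/-- The `i`-th component of `P_g` is the projection to the slot `(i,g)`. [cite: CharlesSchnell2014Notes, proof of Thm. 11.5.21 (pp. 510–511), auxiliary step] -/
theorem Pg_π (g : K ≃ₐ[ℚ] K) (i : Fin n) :
    Pg K A g ≫ biproduct.π A i = biproduct.π (slotAV K A) (i, g) :=
  biproduct.lift_π _ _

/-- The `i`-th component of `π` is the sum over `g` of the projections to the slots `(i,g)`. [cite: CharlesSchnell2014Notes, proof of Thm. 11.5.21 (pp. 510–511), auxiliary step] -/
theorem piSum_π (i : Fin n) :
    piSum K A ≫ biproduct.π A i = ∑ g, biproduct.π (slotAV K A) (i, g) := by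
  unfold piSum
  rw [Preadditive.sum_comp]
  exact Finset.sum_congr rfl fun g _ => Pg_π K A g i

/-- The diagonal action commutes with the slot projections. [cite: CharlesSchnell2014Notes, proof of Thm. 11.5.21 (pp. 510–511), auxiliary step] -/
theorem Yact_π (a : 𝓞 K) (q : Slot K n) :
    Yact K A ι a ≫ biproduct.π (slotAV K A) q =
      biproduct.π (slotAV K A) q ≫ (slotAct K A ι q a : slotAV K A q ⟶ slotAV K A q) := by
  unfold Yact
  exact biproduct.map_π (p := fun q' => (slotAct K A ι q' a : slotAV K A q' ⟶ slotAV K A q')) q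

/-- The line basis of `H¹(B̃)` indexed by `(slot, eigen-embedding)`. [cite: CharlesSchnell2014Notes, proof of Thm. 11.5.21 (pp. 510–511), auxiliary construction] -/
def lineBasis0 (v : ∀ i, Module.Basis (K →+* ℂ) ℂ (complexBetti (A i).X 1)) :
    Module.Basis (Slot K n × (K →+* ℂ)) ℂ (complexBetti (Btilde K A).X 1) :=
  biprodBasis (slotAV K A) fun q => v q.1

variable (v : ∀ i, Module.Basis (K →+* ℂ) ℂ (complexBetti (A i).X 1))

/-- Unfolding of `lineBasis0`. [cite: CharlesSchnell2014Notes, proof of Thm. 11.5.21 (pp. 510–511), auxiliary step] -/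
theorem lineBasis0_apply (q : Slot K n) (σ : K →+* ℂ) :
    lineBasis0 K A v (q, σ) = complexBetti.map (biproduct.π (slotAV K A) q).hom.hom.hom 1 (v q.1 σ) :=
  biprodBasis_apply _ _ _

variable {A ι v}
variable {θ : ∀ i, K →+* Module.End ℂ (complexBetti (A i).X 1)} {Φ : Fin n → CMType K}

/-- The twisted action on the line over slot `(i,g)` with eigen-embedding `σ` is the scalar
`σ(g⁻¹ a)`. [cite: Deligne1982HodgeCycles, endnote M.12 ((A, ν∘σ) is of CM-type Φσ)] -/
theorem map_Yact_lineBasis0 (hA : ∀ i, IsCMTypeRealisation (Φ i) (A i) (ι i) (θ i))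
    (hv : ∀ i σ, v i σ ∈ eigenline (θ i) σ) (a : 𝓞 K) (q : Slot K n) (σ : K →+* ℂ) :
    complexBetti.map (Yact K A ι a).hom.hom.hom 1 (lineBasis0 K A v (q, σ)) =
      (label K q.2 σ) (a : K) • lineBasis0 K A v (q, σ) := by
  rw [lineBasis0_apply, complexBetti_map_map_one_apply, Yact_π, ← complexBetti_map_map_one_apply,
    slotAct_apply, map_ι_apply_of_mem_eigenline (hA q.1) (hv q.1 σ), map_smul, label_apply]
  congr 1

/-- `ι₀^*` of the line over slot `(i,g)` with eigen-embedding `σ` is the line `(i, σ)` of `⨁ A`.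
[cite: Deligne1982HodgeCycles, endnote M.12 (the diagonal map f_J)] -/
theorem map_iota0_lineBasis0 (q : Slot K n) (σ : K →+* ℂ) :
    complexBetti.map (iota0 K A).hom.hom.hom 1 (lineBasis0 K A v (q, σ)) = biprodBasis A v (q.1, σ) := by
  rw [lineBasis0_apply, complexBetti_map_map_one_apply, iota0_π, biprodBasis_apply]

/-- `π^*` of the line `(i, σ)` of `⨁ A` is the sum of the lines over the slots `(i, g)`, all `g`.
 [cite: CharlesSchnell2014Notes, proof of Thm. 11.5.21 (pp. 510–511), auxiliary step] -/
theorem map_piSum_biprodBasis (i : Fin n) (σ : K →+* ℂ) :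
    complexBetti.map (piSum K A).hom.hom.hom 1 (biprodBasis A v (i, σ)) =
      ∑ g : K ≃ₐ[ℚ] K, lineBasis0 K A v ((i, g), σ) := by
  rw [biprodBasis_apply]
  change complexBetti.map (piSum K A).hom.hom.hom 1
    (complexBetti.map (biproduct.π A i).hom.hom.hom 1 (v i σ)) = _
  rw [complexBetti_map_map_one_apply, piSum_π, complexBetti_map_finsetSum_one]
  change ((∑ g : K ≃ₐ[ℚ] K, complexBetti.map (biproduct.π (slotAV K A) (i, g)).hom.hom.hom 1 :
    complexBetti (A i).X 1 ⟶ complexBetti (Btilde K A).X 1)).hom (v i σ) = _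
  rw [ModuleCat.hom_sum, LinearMap.coe_sum, Finset.sum_apply]
  exact Finset.sum_congr rfl fun g _ => (lineBasis0_apply K A v (i, g) σ).symm

end Construction

/-! ## Reindexing to `Fin N × Fin e` (the index convention of the carrier lemmas) -/

section Reindex

open _root_.CategoryTheory _root_.CategoryTheory.Limits
open Literature.AlgebraicGeometry Literature.AlgebraicGeometry.Motives Literature.AlgebraicGeometry.HodgeTheory
open Literature.AlgebraicGeometry.ComplexMultiplication
open Literature.NumberTheory.Automorphic.PicardCM (eigenline)

variable (n : ℕ)

/-- `N = n · [K:ℚ]`, the number of lines of `H¹(⨁ A)`. [cite: CharlesSchnell2014Notes, proof of Thm. 11.5.21 (pp. 510–511), auxiliary construction] -/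
abbrev NN : ℕ := Fintype.card (Fin n × (K →+* ℂ))

/-- `e = [K:ℚ]`, the number of complex embeddings. [cite: CharlesSchnell2014Notes, proof of Thm. 11.5.21 (pp. 510–511), auxiliary construction] -/
abbrev EE : ℕ := Fintype.card (K →+* ℂ)

/-- Enumeration of the lines of `H¹(⨁ A)`. [cite: CharlesSchnell2014Notes, proof of Thm. 11.5.21 (pp. 510–511), auxiliary construction] -/
def eN : Fin n × (K →+* ℂ) ≃ Fin (NN K n) := Fintype.equivFin _

/-- Enumeration of the complex embeddings. [cite: CharlesSchnell2014Notes, proof of Thm. 11.5.21 (pp. 510–511), auxiliary construction] -/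
def ee : (K →+* ℂ) ≃ Fin (EE K) := Fintype.equivFin _

variable [IsGalois ℚ K]

/-- The reindexing `((i,g),σ) ↦ (eN (i,σ), ee (σ ∘ g⁻¹))` of the lines of `H¹(B̃)`. [cite: CharlesSchnell2014Notes, proof of Thm. 11.5.21 (pp. 510–511), auxiliary construction] -/
def idx : Slot K n × (K →+* ℂ) ≃ Fin (NN K n) × Fin (EE K) :=
  ((Equiv.prodAssoc _ _ _).trans (((Equiv.refl _).prodCongr (pairEquiv K)).trans
    (Equiv.prodAssoc _ _ _).symm)).trans ((eN K n).prodCongr (ee K))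

/-- The inverse reindexing: `(l, s) ↦ ((i, galOf s σ), σ)` for `(i, σ) = eN⁻¹ l`. [cite: CharlesSchnell2014Notes, proof of Thm. 11.5.21 (pp. 510–511), auxiliary step] -/
theorem idx_symm_apply (l : Fin (NN K n)) (s : Fin (EE K)) :
    (idx K n).symm (l, s) =
      ((((eN K n).symm l).1, galOf K ((ee K).symm s) ((eN K n).symm l).2), ((eN K n).symm l).2) := by
  simp [idx, pairEquiv, Equiv.prodAssoc, Equiv.prodCongr]

variable {n} (A : Fin n → AbelianVariety ℂ) (ι : ∀ i, 𝓞 K →+* End (A i))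
  (v : ∀ i, Module.Basis (K →+* ℂ) ℂ (complexBetti (A i).X 1))

/-- The line basis `𝔅` of `H¹(B̃)` indexed by `Fin N × Fin e`. [cite: CharlesSchnell2014Notes, proof of Thm. 11.5.21 (pp. 510–511), auxiliary construction] -/
def 𝔅 : Module.Basis (Fin (NN K n) × Fin (EE K)) ℂ (complexBetti (Btilde K A).X 1) :=
  (lineBasis0 K A v).reindex (idx K n)

/-- The basis `xB` of `H¹(⨁ A)` indexed by `Fin N`. [cite: CharlesSchnell2014Notes, proof of Thm. 11.5.21 (pp. 510–511), auxiliary construction] -/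
def xB : Module.Basis (Fin (NN K n)) ℂ (complexBetti (⨁ A).X 1) :=
  (biprodBasis A v).reindex (eN K n)

/-- The reindexed line `𝔅 (l, s)` is the line over the slot `(i, galOf s σ)` with eigen-embedding `σ`. [cite: CharlesSchnell2014Notes, proof of Thm. 11.5.21 (pp. 510–511), auxiliary step] -/
theorem 𝔅_apply (l : Fin (NN K n)) (s : Fin (EE K)) :
    𝔅 K A v (l, s) = lineBasis0 K A v
      ((((eN K n).symm l).1, galOf K ((ee K).symm s) ((eN K n).symm l).2), ((eN K n).symm l).2) := by
  rw [𝔅, Module.Basis.reindex_apply, idx_symm_apply]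

omit [IsGalois ℚ K] in
/-- Unfolding of `xB`. [cite: CharlesSchnell2014Notes, proof of Thm. 11.5.21 (pp. 510–511), auxiliary step] -/
theorem xB_apply (l : Fin (NN K n)) : xB K A v l = biprodBasis A v ((eN K n).symm l) := by
  rw [xB, Module.Basis.reindex_apply]

variable {A ι v}
variable {θ : ∀ i, K →+* Module.End ℂ (complexBetti (A i).X 1)} {Φ : Fin n → CMType K}

/-- `Y_a^* 𝔅(l,s) = s(a) · 𝔅(l,s)`. [cite: Deligne1982HodgeCycles, endnote M.12] -/
theorem map_Yact_𝔅 (hA : ∀ i, IsCMTypeRealisation (Φ i) (A i) (ι i) (θ i))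
    (hv : ∀ i σ, v i σ ∈ eigenline (θ i) σ) (a : 𝓞 K) (l : Fin (NN K n)) (s : Fin (EE K)) :
    complexBetti.map (Yact K A ι a).hom.hom.hom 1 (𝔅 K A v (l, s)) =
      ((ee K).symm s) (a : K) • 𝔅 K A v (l, s) := by
  rw [𝔅_apply, map_Yact_lineBasis0 K hA hv]
  simp only [label_galOf]

/-- `ι₀^* 𝔅(l,s) = xB l`. [cite: Deligne1982HodgeCycles, endnote M.12] -/
theorem map_iota0_𝔅 (l : Fin (NN K n)) (s : Fin (EE K)) :
    complexBetti.map (iota0 K A).hom.hom.hom 1 (𝔅 K A v (l, s)) = xB K A v l := by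
  rw [𝔅_apply, map_iota0_lineBasis0, xB_apply]

/-- For fixed `σ`, `s ↦ galOf s σ` is a bijection onto the Galois group. [cite: CharlesSchnell2014Notes, proof of Thm. 11.5.21 (pp. 510–511), auxiliary construction] -/
def galEquiv (σ : K →+* ℂ) : (K →+* ℂ) ≃ (K ≃ₐ[ℚ] K) where
  toFun s := galOf K s σ
  invFun g := label K g σ
  left_inv s := label_galOf K s σ
  right_inv g := galOf_label K g σ

/-- `π^* (xB l) = Σ_s 𝔅(l,s)`. [cite: CharlesSchnell2014Notes, proof of Thm. 11.5.21 (pp. 510–511), auxiliary step] -/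
theorem map_piSum_xB (l : Fin (NN K n)) :
    complexBetti.map (piSum K A).hom.hom.hom 1 (xB K A v l) = ∑ s, 𝔅 K A v (l, s) := by
  rw [xB_apply]
  set i := ((eN K n).symm l).1
  set σ := ((eN K n).symm l).2
  have hl : (eN K n).symm l = (i, σ) := rfl
  rw [hl, map_piSum_biprodBasis]
  simp_rw [𝔅_apply]
  exact (Equiv.sum_comp ((ee K).symm.trans (galEquiv K σ)) (fun g => lineBasis0 K A v ((i, g), σ))).symm

end Reindex

/-! ## The twisted slot products `B_α`, their inclusions and projections -/

section SlotProducts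

open _root_.CategoryTheory _root_.CategoryTheory.Limits
open Literature.AlgebraicGeometry Literature.AlgebraicGeometry.Motives Literature.AlgebraicGeometry.HodgeTheory
open Literature.AlgebraicGeometry.ComplexMultiplication
open Literature.NumberTheory.Automorphic.PicardCM (eigenline)

variable {n : ℕ} (A : Fin n → AbelianVariety ℂ) (ι : ∀ i, 𝓞 K →+* End (A i))
variable {d : ℕ} (α : Finset (Slot K n)) (hα : α.card = d)

/-- Enumeration of the slots of `α` by `Fin d`. [cite: CharlesSchnell2014Notes, proof of Thm. 11.5.21 (pp. 510–511), auxiliary construction] -/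
def slotOf (j : Fin d) : Slot K n := ((α.equivFinOfCardEq hα).symm j : α)

/-- `slotOf j ∈ α`. [cite: CharlesSchnell2014Notes, proof of Thm. 11.5.21 (pp. 510–511), auxiliary step] -/
theorem slotOf_mem (j : Fin d) : slotOf K α hα j ∈ α := ((α.equivFinOfCardEq hα).symm j).2

/-- The enumeration of the slots of `α` is injective. [cite: CharlesSchnell2014Notes, proof of Thm. 11.5.21 (pp. 510–511), auxiliary step] -/
theorem slotOf_injective : Function.Injective (slotOf K α hα) := by
  intro j j' h
  exact (α.equivFinOfCardEq hα).symm.injective (Subtype.ext h)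

/-- Every slot of `α` is enumerated. [cite: CharlesSchnell2014Notes, proof of Thm. 11.5.21 (pp. 510–511), auxiliary step] -/
theorem exists_slotOf_eq {q : Slot K n} (hq : q ∈ α) : ∃ j, slotOf K α hα j = q :=
  ⟨α.equivFinOfCardEq hα ⟨q, hq⟩, by simp [slotOf]⟩

/-- `B_α = ⨁_j A_{i_j}`. [cite: Deligne1982HodgeCycles, endnote M.12 (A_J)] -/
abbrev Bα : AbelianVariety ℂ := ⨁ fun j : Fin d => A (slotOf K α hα j).1

/-- `q_α : B̃ ⟶ B_α`, the projection onto the slots of `α`. [cite: CharlesSchnell2014Notes, proof of Thm. 11.5.21 (pp. 510–511), auxiliary construction] -/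
def qα : Btilde K A ⟶ Bα K A α hα := biproduct.lift fun j => biproduct.π (slotAV K A) (slotOf K α hα j)

/-- `j_α : B_α ⟶ B̃`, the inclusion of the slots of `α`. [cite: CharlesSchnell2014Notes, proof of Thm. 11.5.21 (pp. 510–511), auxiliary construction] -/
def jα : Bα K A α hα ⟶ Btilde K A := biproduct.desc fun j => biproduct.ι (slotAV K A) (slotOf K α hα j)

/-- The twisted diagonal action on `B_α`. [cite: Deligne1982HodgeCycles, endnote M.12] -/
def Yα (a : 𝓞 K) : Bα K A α hα ⟶ Bα K A α hα := biproduct.map fun j => slotAct K A ι (slotOf K α hα j) a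

/-- `ι₀ ≫ q_α` is the multi-diagonal `(pr_{i_j})_j`. [cite: Milne2020HodgeClassesAV, Theorem 1 (proof: f_Δ)] -/
theorem iota0_qα : iota0 K A ≫ qα K A α hα = biproduct.lift fun j => biproduct.π A (slotOf K α hα j).1 := by
  apply biproduct.hom_ext
  intro j
  rw [Category.assoc, qα, biproduct.lift_π, iota0_π, biproduct.lift_π]

/-- `j_α` is `𝓞_K`-equivariant for the twisted diagonal actions. [cite: CharlesSchnell2014Notes, proof of Thm. 11.5.21 (pp. 510–511), auxiliary step] -/
theorem jα_Yact (a : 𝓞 K) : jα K A α hα ≫ Yact K A ι a = Yα K A ι α hα a ≫ jα K A α hα := by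
  apply biproduct.hom_ext'
  intro j
  rw [jα, Yα, biproduct.ι_desc_assoc, Yact, biproduct.ι_map, biproduct.ι_map_assoc, biproduct.ι_desc]

/-- `j_α` followed by the projection to an `α`-slot is the corresponding projection of `B_α`. [cite: CharlesSchnell2014Notes, proof of Thm. 11.5.21 (pp. 510–511), auxiliary step] -/
theorem jα_π_slotOf (j : Fin d) :
    jα K A α hα ≫ biproduct.π (slotAV K A) (slotOf K α hα j) = biproduct.π _ j := by
  classical
  apply biproduct.hom_ext'
  intro j'
  rw [jα, biproduct.ι_desc_assoc]
  by_cases h : j' = j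
  · subst h
    rw [biproduct.ι_π_self, biproduct.ι_π_self]
  · rw [biproduct.ι_π_ne _ h, biproduct.ι_π_ne _ (fun h' => h (slotOf_injective K α hα h'))]

/-- `j_α` followed by the projection to a slot outside `α` vanishes. [cite: CharlesSchnell2014Notes, proof of Thm. 11.5.21 (pp. 510–511), auxiliary step] -/
theorem jα_π_of_not_mem {q : Slot K n} (hq : q ∉ α) :
    jα K A α hα ≫ biproduct.π (slotAV K A) q = 0 := by
  apply biproduct.hom_ext'
  intro j'
  rw [jα, biproduct.ι_desc_assoc, comp_zero]
  exact biproduct.ι_π_ne _ fun h' : slotOf K α hα j' = q => hq (h' ▸ slotOf_mem K α hα j')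

/-- The slot idempotent `q_α ≫ j_α` fixes the `α`-slot projections. [cite: CharlesSchnell2014Notes, proof of Thm. 11.5.21 (pp. 510–511), auxiliary step] -/
theorem qα_jα_π_slotOf (j : Fin d) :
    (qα K A α hα ≫ jα K A α hα) ≫ biproduct.π (slotAV K A) (slotOf K α hα j) =
      biproduct.π (slotAV K A) (slotOf K α hα j) := by
  rw [Category.assoc, jα_π_slotOf, qα, biproduct.lift_π]

/-- The slot idempotent `q_α ≫ j_α` kills the projections to slots outside `α`. [cite: CharlesSchnell2014Notes, proof of Thm. 11.5.21 (pp. 510–511), auxiliary step] -/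
theorem qα_jα_π_of_not_mem {q : Slot K n} (hq : q ∉ α) :
    (qα K A α hα ≫ jα K A α hα) ≫ biproduct.π (slotAV K A) q = 0 := by
  rw [Category.assoc, jα_π_of_not_mem K A α hα hq, comp_zero]

variable (v : ∀ i, Module.Basis (K →+* ℂ) ℂ (complexBetti (A i).X 1))

open scoped Classical in
/-- The slot idempotent `e_α = q_α ≫ j_α` acts on the lines of `H¹(B̃)` by the indicator of `α`. [cite: CharlesSchnell2014Notes, proof of Thm. 11.5.21 (pp. 510–511), auxiliary step] -/
theorem map_eα_lineBasis0 (q : Slot K n) (σ : K →+* ℂ) :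
    complexBetti.map (qα K A α hα ≫ jα K A α hα).hom.hom.hom 1 (lineBasis0 K A v (q, σ)) =
      (if q ∈ α then (1 : ℂ) else 0) • lineBasis0 K A v (q, σ) := by
  rw [lineBasis0_apply, complexBetti_map_map_one_apply]
  split_ifs with hq
  · obtain ⟨j, rfl⟩ := exists_slotOf_eq K α hα hq
    rw [qα_jα_π_slotOf, one_smul]
  · rw [qα_jα_π_of_not_mem K A α hα hq, zero_smul]
    exact complexBetti_map_zero_one_apply _

/-- `j_α^*` of the line over the slot `slotOf j` is the line `(j, σ)` of `B_α`. [cite: CharlesSchnell2014Notes, proof of Thm. 11.5.21 (pp. 510–511), auxiliary step] -/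
theorem map_jα_lineBasis0_slotOf (j : Fin d) (σ : K →+* ℂ) :
    complexBetti.map (jα K A α hα).hom.hom.hom 1 (lineBasis0 K A v (slotOf K α hα j, σ)) =
      biprodBasis (fun j : Fin d => A (slotOf K α hα j).1) (fun j => v (slotOf K α hα j).1) (j, σ) := by
  rw [lineBasis0_apply, complexBetti_map_map_one_apply, jα_π_slotOf, biprodBasis_apply]

end SlotProducts

end Literature.AlgebraicGeometry.ComplexMultiplication.AndreProductForm
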